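import Summits.SmoothPoincare4.SmoothPoincare4.Theorems.ConvexBisectionAcyclicBisectionExistsSeamTwistSignFrame
import Literature.Geometry.Symplectic.SteinBallLegendrian
import HarnessLib

/-!
# Hgap ▸ part B (page twisting of the straightened dual framed knot), brick G2-2: the winding count
(wave 6, crux stmt-SmoothPoincare4-10508, line `modp-braid-orbits`, stub `stub_T3_dualPresentation` (T3)
▸ node `Hgap` ▸ part B `helper_Hgap_twisting`; registered sub-goal `helper_wind_beltCount`)

The page twisting of the dual (belt) framed knot is computed, at the belt circle `B = {x_λ = 0}` of the
handle sphere `∂D⁴`, from the FIRST-ORDER STRUCTURE of the boundary open book `Θ` there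
(`G2-REPORT.md`): `dΘ_{(0,u)}(v, 0) = ⟪M u, v⟫` for an invertible `2 × 2` matrix `M = [ℓ_F | ℓ_G]`
whose columns are read off the attaching framing `F = dh̄(e₂)` and its companion `G = dh̄(e₃)` of the
`j`-th handle at the core (`⟪F(v), n⟫ / ‖n‖² = ⟪ℓ_F, v⟫`, `⟪G(v), n⟫ / ‖n‖² = ⟪ℓ_G, v⟫`), and the
twisting loop of the pushed belt framing is pointwise-frame equivalent
(`helper_wind_pointwiseFrame`, X3) to the loop `m(u) = (σ (M u)₂, (M u)₁)` (`σ = ±1` the orientation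
behaviour of the pushed map on page planes).  This file is the PLANE TOPOLOGY of the count:

* §1 reflections: `wind (ℓ₂, ℓ₁) = - wind ℓ` (`wind_swap`), `wind (-ℓ₁, ℓ₂) = - wind ℓ` (`wind_neg_re`);
* §2 **linear loops**: `t ↦ M (cos 2πt, sin 2πt)` winds `sign det M` times (`wind_linearLoop`), and a
  linear loop is non-vanishing only if `det M ≠ 0` (`det_ne_zero_of_linearLoop_ne_zero`);
* §3 **the row/column lemma** (`wind_frameRow`): if the frame matrix `[[f₁, g₁], [f₂, g₂]](t)` has
  determinant of constant sign `ε`, then `wind (f₂, g₂) = -ε · wind (f₁, f₂)` (for a rotation field the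
  second ROW winds opposite to the first COLUMN);
* §4 **the count** (`wind_beltCount`, registered `helper_wind_beltCount`): with `f₂ = ⟪ℓ_F, u⟫`,
  `g₂ = ⟪ℓ_G, u⟫` linear and `t := wind (f₁, f₂)` (the page twisting of the attaching framing),
  `wind m = σ · ε · t`.

Everything is proved; no named facts, no `sorry`.  References: W. Fulton, *Algebraic Topology: A First
Course* (1995), §3 [Fulton1995]; J. B. Etnyre, T. Fuller, IMRN 2006, Thm. 1 (proof, p. 8)
[EtnyreFuller2006].
-/

noncomputable section

set_option linter.dupNamespace false

open scoped ComplexConjugate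
open Set Function Complex
open Literature.Topology.PlaneTopology Literature.Geometry.Symplectic

namespace Summit.SmoothPoincare4.SmoothPoincare4.Theorems.AcyclicBisectionExists.ModpBraidOrbits

/-! ## §1 Reflections of loops -/

/-- The conjugate of a non-vanishing loop is a non-vanishing loop. [folklore] -/
theorem isNonvanishingLoop_conj {f : ℝ → ℂ} (hf : IsNonvanishingLoop f) :
    IsNonvanishingLoop fun t => conj (f t) :=
  ⟨Complex.continuous_conj.comp_continuousOn hf.continuousOn,
    fun t ht => (map_ne_zero _).2 (hf.ne_zero t ht), by simp only [hf.eq_endpoints]⟩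

/-- **Swapping the coordinates reverses the winding number**: `wind (ℓ₂, ℓ₁) = - wind ℓ`
(`(y, x) = i · conj (x, y)`). [cite: Fulton1995, §3] -/
theorem wind_swap {f : ℝ → ℂ} (hf : IsNonvanishingLoop f) :
    wind (fun t => (⟨(f t).im, (f t).re⟩ : ℂ)) = -wind f := by
  have e : (fun t => (⟨(f t).im, (f t).re⟩ : ℂ)) = fun t => I * conj (f t) := by
    funext t
    apply Complex.ext <;> simp
  rw [e, wind_mul (IsNonvanishingLoop.const I_ne_zero) (isNonvanishingLoop_conj hf), wind_const,
    zero_add, wind_conj hf]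

/-- **Reflecting the first coordinate reverses the winding number**: `wind (-ℓ₁, ℓ₂) = - wind ℓ`
(`(-x, y) = - conj (x, y)`). [cite: Fulton1995, §3] -/
theorem wind_neg_re {f : ℝ → ℂ} (hf : IsNonvanishingLoop f) :
    wind (fun t => (⟨-(f t).re, (f t).im⟩ : ℂ)) = -wind f := by
  have e : (fun t => (⟨-(f t).re, (f t).im⟩ : ℂ)) = fun t => -conj (f t) := by
    funext t
    apply Complex.ext <;> simp
  rw [e, wind_neg (isNonvanishingLoop_conj hf), wind_conj hf]

/-- **Multiplying by `i` keeps the winding number**: `wind (-ℓ₂, ℓ₁) = wind ℓ`. [cite: Fulton1995, §3] -/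
theorem wind_rot {f : ℝ → ℂ} (hf : IsNonvanishingLoop f) :
    wind (fun t => (⟨-(f t).im, (f t).re⟩ : ℂ)) = wind f := by
  have e : (fun t => (⟨-(f t).im, (f t).re⟩ : ℂ)) = fun t => I * f t := by
    funext t
    apply Complex.ext <;> simp
  rw [e, wind_mul (IsNonvanishingLoop.const I_ne_zero) hf, wind_const, zero_add]

/-! ## §2 Linear loops -/

/-- Every unit direction is `(cos 2πt, sin 2πt)` for some `t`. [folklore] -/
theorem exists_cos_sin_eq {x y : ℝ} (h : x ^ 2 + y ^ 2 = 1) :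
    ∃ t : ℝ, Real.cos (2 * Real.pi * t) = x ∧ Real.sin (2 * Real.pi * t) = y := by
  have hz : (⟨x, y⟩ : ℂ) ≠ 0 := by
    intro h0
    have hx : x = 0 := congrArg Complex.re h0
    have hy : y = 0 := congrArg Complex.im h0
    rw [hx, hy] at h; norm_num at h
  have hn : ‖(⟨x, y⟩ : ℂ)‖ = 1 := by
    rw [Complex.norm_def, Complex.normSq_mk, ← sq, ← sq, h, Real.sqrt_one]
  refine ⟨Complex.arg ⟨x, y⟩ / (2 * Real.pi), ?_, ?_⟩
  · rw [mul_div_cancel₀ _ (by positivity), Complex.cos_arg hz, hn, div_one]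
  · rw [mul_div_cancel₀ _ (by positivity), Complex.sin_arg, hn, div_one]

/-- Where a linear form `c cos + d sin` vanishes on the unit circle, the companion form
`d cos - c sin` squares to `c² + d²` and `(a cos + b sin) · (d cos - c sin) = ad - bc`. [folklore] -/
theorem linearLoop_kernel_identities {a b c d C S : ℝ} (hCS : C ^ 2 + S ^ 2 = 1)
    (h0 : c * C + d * S = 0) :
    (d * C - c * S) ^ 2 = c ^ 2 + d ^ 2 ∧ (a * C + b * S) * (d * C - c * S) = a * d - b * c := by
  constructor
  · linear_combination (c ^ 2 + d ^ 2) * hCS - (c * C + d * S) * h0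
  · linear_combination (a * d - b * c) * hCS + (b * C - a * S) * h0

/-- **The reference linear loop `(d cos − c sin, c cos + d sin) = (d + ic) e^{2πit}` winds once**
(`(c, d) ≠ 0`). [cite: Fulton1995, §3] -/
theorem wind_refLoop {c d : ℝ} (h : c ^ 2 + d ^ 2 ≠ 0) :
    wind (fun t => (⟨d * Real.cos (2 * Real.pi * t) - c * Real.sin (2 * Real.pi * t),
      c * Real.cos (2 * Real.pi * t) + d * Real.sin (2 * Real.pi * t)⟩ : ℂ)) = 1 := by
  have hcd : (⟨d, c⟩ : ℂ) ≠ 0 := by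
    intro h0
    have hd : d = 0 := congrArg Complex.re h0
    have hc : c = 0 := congrArg Complex.im h0
    exact h (by rw [hc, hd]; ring)
  have e : (fun t => (⟨d * Real.cos (2 * Real.pi * t) - c * Real.sin (2 * Real.pi * t),
      c * Real.cos (2 * Real.pi * t) + d * Real.sin (2 * Real.pi * t)⟩ : ℂ)) =
      fun t => (⟨d, c⟩ : ℂ) * circleLoop 0 1 t := by
    funext t
    rw [circleLoop_apply, zero_add, ofReal_one, one_mul]
    have hre : (exp (2 * (Real.pi : ℂ) * (t : ℂ) * I)).re = Real.cos (2 * Real.pi * t) := by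
      rw [Complex.exp_re]; simp
    have him : (exp (2 * (Real.pi : ℂ) * (t : ℂ) * I)).im = Real.sin (2 * Real.pi * t) := by
      rw [Complex.exp_im]; simp
    apply Complex.ext
    · rw [Complex.mul_re, hre, him]
    · rw [Complex.mul_im, hre, him]; ring
  rw [e, wind_mul (IsNonvanishingLoop.const hcd)
    (isNonvanishingLoop_circleLoop (c := 0) (R := 1) (by norm_num)), wind_const, zero_add,
    wind_circleLoop_zero one_pos]

/-- **A linear loop `t ↦ M (cos 2πt, sin 2πt)`, `M = [[a, b], [c, d]]`, winds `sign (det M)` times**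
(`det M = ad − bc ≠ 0`): it is pointwise-frame equivalent to the reference loop
`(σ (d cos − c sin), c cos + d sin)`, `σ = sign det M`. [cite: Fulton1995, §3] -/
theorem wind_linearLoop {a b c d : ℝ} {σ : ℤ} (hσ : σ = 1 ∨ σ = -1)
    (hdet : 0 < (σ : ℝ) * (a * d - b * c)) :
    wind (fun t => (⟨a * Real.cos (2 * Real.pi * t) + b * Real.sin (2 * Real.pi * t),
      c * Real.cos (2 * Real.pi * t) + d * Real.sin (2 * Real.pi * t)⟩ : ℂ)) = σ := by
  have hcd : c ^ 2 + d ^ 2 ≠ 0 := by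
    intro h0
    have hc : c = 0 := by nlinarith [sq_nonneg c, sq_nonneg d]
    have hd : d = 0 := by nlinarith [sq_nonneg c, sq_nonneg d]
    rw [hc, hd] at hdet; simp at hdet
  have hCS : ∀ t : ℝ, Real.cos (2 * Real.pi * t) ^ 2 + Real.sin (2 * Real.pi * t) ^ 2 = 1 := fun t =>
    Real.cos_sq_add_sin_sq _
  -- the reference loop never vanishes
  have hne : ∀ t : ℝ, (⟨d * Real.cos (2 * Real.pi * t) - c * Real.sin (2 * Real.pi * t),
      c * Real.cos (2 * Real.pi * t) + d * Real.sin (2 * Real.pi * t)⟩ : ℂ) ≠ 0 := by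
    intro t h0
    have h2 : c * Real.cos (2 * Real.pi * t) + d * Real.sin (2 * Real.pi * t) = 0 := congrArg Complex.im h0
    have h1 : d * Real.cos (2 * Real.pi * t) - c * Real.sin (2 * Real.pi * t) = 0 := congrArg Complex.re h0
    have := (linearLoop_kernel_identities (a := a) (b := b) (hCS t) h2).1
    rw [h1] at this
    exact hcd (by nlinarith [this])
  have hper : ∀ t : ℝ, Real.cos (2 * Real.pi * (1 : ℝ)) = Real.cos (2 * Real.pi * (0 : ℝ)) ∧
      Real.sin (2 * Real.pi * (1 : ℝ)) = Real.sin (2 * Real.pi * (0 : ℝ)) := fun _ => by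
    simp [Real.cos_two_pi, Real.sin_two_pi]
  have key := wind_eq_of_pointwise_frame (σ := σ)
    (ℓ := fun t => (⟨d * Real.cos (2 * Real.pi * t) - c * Real.sin (2 * Real.pi * t),
      c * Real.cos (2 * Real.pi * t) + d * Real.sin (2 * Real.pi * t)⟩ : ℂ))
    (ℓ' := fun t => (⟨a * Real.cos (2 * Real.pi * t) + b * Real.sin (2 * Real.pi * t),
      c * Real.cos (2 * Real.pi * t) + d * Real.sin (2 * Real.pi * t)⟩ : ℂ))
    (continuous_complex_mk (by fun_prop) (by fun_prop)) (continuous_complex_mk (by fun_prop) (by fun_prop))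
    (by rw [(hper 0).1, (hper 0).2]) (by rw [(hper 0).1, (hper 0).2]) hne hσ
    (fun t _ => ⟨1, one_pos, by simp⟩) ?_
  · rw [key, wind_refLoop hcd, mul_one]
  · intro t _ h2
    have h2' : c * Real.cos (2 * Real.pi * t) + d * Real.sin (2 * Real.pi * t) = 0 := h2
    obtain ⟨hsq, hprod⟩ := linearLoop_kernel_identities (a := a) (b := b) (hCS t) h2'
    have hx0 : d * Real.cos (2 * Real.pi * t) - c * Real.sin (2 * Real.pi * t) ≠ 0 := fun h0 =>
      hcd (by rw [← hsq, h0]; ring)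
    have hpos : 0 < c ^ 2 + d ^ 2 := lt_of_le_of_ne (by positivity) (Ne.symm hcd)
    refine ⟨(a * d - b * c) / (c ^ 2 + d ^ 2), ?_, ?_⟩
    · rw [← mul_div_assoc]
      exact div_pos hdet hpos
    · show a * Real.cos (2 * Real.pi * t) + b * Real.sin (2 * Real.pi * t) =
        (a * d - b * c) / (c ^ 2 + d ^ 2) *
          (d * Real.cos (2 * Real.pi * t) - c * Real.sin (2 * Real.pi * t))
      rw [div_mul_eq_mul_div, eq_div_iff hpos.ne', ← hsq]
      linear_combination (d * Real.cos (2 * Real.pi * t) - c * Real.sin (2 * Real.pi * t)) * hprod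

/-- **A non-vanishing linear loop has invertible matrix**: if `(a cos + b sin, c cos + d sin)` never
vanishes then `ad − bc ≠ 0` (a kernel vector of `M` is hit by the unit circle). [folklore] -/
theorem det_ne_zero_of_linearLoop_ne_zero {a b c d : ℝ}
    (hne : ∀ t : ℝ, (a * Real.cos (2 * Real.pi * t) + b * Real.sin (2 * Real.pi * t),
      c * Real.cos (2 * Real.pi * t) + d * Real.sin (2 * Real.pi * t)) ≠ (0, 0)) :
    a * d - b * c ≠ 0 := by
  intro hdet
  -- a non-zero kernel vector `k` of `M`: `(b, -a)` if `(a, b) ≠ 0`, else `(d, -c)`, else anything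
  obtain ⟨k₁, k₂, hk, hk1, hk2⟩ : ∃ k₁ k₂ : ℝ, k₁ ^ 2 + k₂ ^ 2 ≠ 0 ∧ a * k₁ + b * k₂ = 0 ∧
      c * k₁ + d * k₂ = 0 := by
    by_cases hab : a ^ 2 + b ^ 2 = 0
    · have ha : a = 0 := by nlinarith [sq_nonneg a, sq_nonneg b]
      have hb : b = 0 := by nlinarith [sq_nonneg a, sq_nonneg b]
      by_cases hcd : c ^ 2 + d ^ 2 = 0
      · have hc : c = 0 := by nlinarith [sq_nonneg c, sq_nonneg d]
        have hd : d = 0 := by nlinarith [sq_nonneg c, sq_nonneg d]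
        exact ⟨1, 0, by norm_num, by rw [ha, hb]; ring, by rw [hc, hd]; ring⟩
      · exact ⟨d, -c, by intro h0; exact hcd (by nlinarith [h0]), by rw [ha, hb]; ring, by ring⟩
    · exact ⟨b, -a, by intro h0; exact hab (by nlinarith [h0]), by ring, by linear_combination -hdet⟩
  have hkpos : 0 < k₁ ^ 2 + k₂ ^ 2 := lt_of_le_of_ne (by positivity) (Ne.symm hk)
  set r := Real.sqrt (k₁ ^ 2 + k₂ ^ 2) with hr
  have hrpos : 0 < r := Real.sqrt_pos.2 hkpos
  have hr2 : r ^ 2 = k₁ ^ 2 + k₂ ^ 2 := Real.sq_sqrt hkpos.le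
  obtain ⟨t, htc, hts⟩ := exists_cos_sin_eq (x := k₁ / r) (y := k₂ / r)
    (by rw [div_pow, div_pow, ← add_div, hr2, div_self hkpos.ne'])
  refine hne t ?_
  rw [htc, hts, Prod.mk.injEq]
  constructor
  · rw [mul_div_assoc', mul_div_assoc', ← add_div, hk1, zero_div]
  · rw [mul_div_assoc', mul_div_assoc', ← add_div, hk2, zero_div]

/-! ## §3 The row/column lemma -/

/-- **Rows wind opposite to columns.**  Let `f₁, f₂, g₁, g₂` be continuous and `1`-periodic on
`[0, 1]` with the frame determinant `f₁ g₂ − g₁ f₂` of constant sign `ε = ±1`.  Then the second ROW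
`(f₂, g₂)` winds `-ε` times the first COLUMN `(f₁, f₂)`: `wind (f₂, g₂) = -ε · wind (f₁, f₂)` (for the
rotation field `[[cos, -sin], [sin, cos]]` the row `(sin, cos)` is the reflection of the column
`(cos, sin)` in the diagonal).  Proof: `(ε g₂, f₂)` is pointwise-frame equivalent to `(f₁, f₂)`
(`helper_wind_pointwiseFrame`), then reflect and swap. [cite: Fulton1995, §3] -/
theorem wind_frameRow {f₁ f₂ g₁ g₂ : ℝ → ℝ} {ε : ℤ} (hf₁ : Continuous f₁) (hf₂ : Continuous f₂)
    (hg₂ : Continuous g₂) (h₁ : f₁ 0 = f₁ 1) (h₂ : f₂ 0 = f₂ 1) (h₃ : g₂ 0 = g₂ 1)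
    (hε : ε = 1 ∨ ε = -1) (hdet : ∀ t : ℝ, 0 < (ε : ℝ) * (f₁ t * g₂ t - g₁ t * f₂ t)) :
    wind (fun t => (⟨f₂ t, g₂ t⟩ : ℂ)) = -ε * wind (fun t => (⟨f₁ t, f₂ t⟩ : ℂ)) := by
  have hε2 : (ε : ℝ) * ε = 1 := by rcases hε with h | h <;> simp [h]
  -- the column and the row never vanish
  have hneC : ∀ t, (⟨f₁ t, f₂ t⟩ : ℂ) ≠ 0 := by
    intro t h0
    have e1 : f₁ t = 0 := congrArg Complex.re h0
    have e2 : f₂ t = 0 := congrArg Complex.im h0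
    have := hdet t
    rw [e1, e2] at this; simp at this
  have hneR : ∀ t, (⟨g₂ t, f₂ t⟩ : ℂ) ≠ 0 := by
    intro t h0
    have e1 : g₂ t = 0 := congrArg Complex.re h0
    have e2 : f₂ t = 0 := congrArg Complex.im h0
    have := hdet t
    rw [e1, e2] at this; simp at this
  have hR : IsNonvanishingLoop fun t => (⟨g₂ t, f₂ t⟩ : ℂ) :=
    ⟨(continuous_complex_mk hg₂ hf₂).continuousOn, fun t _ => hneR t, by
      apply Complex.ext <;> simp [h₂, h₃]⟩
  -- step 1: `wind (ε g₂, f₂) = wind (f₁, f₂)`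
  have step1 : wind (fun t => (⟨ε * g₂ t, f₂ t⟩ : ℂ)) = wind (fun t => (⟨f₁ t, f₂ t⟩ : ℂ)) := by
    have key := wind_eq_of_pointwise_frame (σ := 1) (ℓ := fun t => (⟨f₁ t, f₂ t⟩ : ℂ))
      (ℓ' := fun t => (⟨ε * g₂ t, f₂ t⟩ : ℂ)) (continuous_complex_mk hf₁ hf₂)
      (continuous_complex_mk (continuous_const.mul hg₂) hf₂)
      (by apply Complex.ext <;> simp [h₁, h₂]) (by apply Complex.ext <;> simp [h₂, h₃]) hneC
      (Or.inl rfl) (fun t _ => ⟨1, one_pos, by simp⟩) ?_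
    · rw [key]; simp
    · intro t _ h0
      have h0' : f₂ t = 0 := h0
      have hd := hdet t
      rw [h0', mul_zero, sub_zero] at hd
      have hf0 : f₁ t ≠ 0 := by intro h; rw [h] at hd; simp at hd
      refine ⟨ε * g₂ t / f₁ t, ?_, ?_⟩
      · rw [Int.cast_one, one_mul]
        have : (ε : ℝ) * g₂ t / f₁ t = (ε : ℝ) * (f₁ t * g₂ t) / f₁ t ^ 2 := by
          field_simp
        rw [this]
        exact div_pos hd (by positivity)
      · show (ε : ℝ) * g₂ t = ε * g₂ t / f₁ t * f₁ t
        field_simp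
  -- step 2: `wind (g₂, f₂) = ε · wind (ε g₂, f₂)`
  have step2 : wind (fun t => (⟨g₂ t, f₂ t⟩ : ℂ)) = ε * wind (fun t => (⟨ε * g₂ t, f₂ t⟩ : ℂ)) := by
    rcases hε with h | h
    · subst h; simp
    · subst h
      have e : (fun t => (⟨((-1 : ℤ) : ℝ) * g₂ t, f₂ t⟩ : ℂ)) =
          fun t => (⟨-((⟨g₂ t, f₂ t⟩ : ℂ)).re, ((⟨g₂ t, f₂ t⟩ : ℂ)).im⟩ : ℂ) := by
        funext t; apply Complex.ext <;> simp
      rw [e, wind_neg_re hR]; simp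
  -- step 3: swap
  have step3 : wind (fun t => (⟨f₂ t, g₂ t⟩ : ℂ)) = -wind (fun t => (⟨g₂ t, f₂ t⟩ : ℂ)) := by
    have := wind_swap hR
    exact this
  rw [step3, step2, step1, neg_mul]

/-! ## §4 The belt count -/

/-- **The winding count of the belt twisting** (brick G2-2).  Data: an invertible-looking `2 × 2` matrix
`M = [[p, q], [r, s]]` (columns `ℓ_F = (p, r)`, `ℓ_G = (q, s)`), continuous `1`-periodic `f₁, g₁`
(the in-page components of the attaching framing `F` and of its companion `G` at the core point
`u(t) = (cos 2πt, sin 2πt)`), the LINEAR normal components `f₂ = ⟪ℓ_F, u⟫ = p cos + r sin`,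
`g₂ = ⟪ℓ_G, u⟫ = q cos + s sin`, a frame determinant `f₁ g₂ − g₁ f₂` of constant sign `ε = ±1`
(`h̄` is an embedding), and `σ = ±1`.  Then the model loop `m = (σ (M u)₂, (M u)₁)`,
`M u = (p cos + q sin, r cos + s sin)`, winds `σ · ε · wind (f₁, f₂)` times: `wind (f₂, g₂) = -ε t`
(`wind_frameRow`) is the linear loop of `Mᵀ`, so `sign det M = -ε t` (`wind_linearLoop`,
`det_ne_zero_of_linearLoop_ne_zero`), and `wind m = -σ · wind (M u) = σ ε t`.
[cite: EtnyreFuller2006, Thm. 1 (proof, p. 8)] -/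
theorem wind_beltCount {p q r s : ℝ} {f₁ g₁ : ℝ → ℝ} {ε σ : ℤ} (hf₁ : Continuous f₁)
    (h₁ : f₁ 0 = f₁ 1) (hε : ε = 1 ∨ ε = -1) (hσ : σ = 1 ∨ σ = -1)
    (hdet : ∀ t : ℝ, 0 < (ε : ℝ) * (f₁ t * (q * Real.cos (2 * Real.pi * t) + s * Real.sin (2 * Real.pi * t)) -
      g₁ t * (p * Real.cos (2 * Real.pi * t) + r * Real.sin (2 * Real.pi * t)))) :
    wind (fun t => (⟨σ * (r * Real.cos (2 * Real.pi * t) + s * Real.sin (2 * Real.pi * t)),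
        p * Real.cos (2 * Real.pi * t) + q * Real.sin (2 * Real.pi * t)⟩ : ℂ)) =
      σ * ε * wind (fun t => (⟨f₁ t, p * Real.cos (2 * Real.pi * t) + r * Real.sin (2 * Real.pi * t)⟩ : ℂ)) := by
  have hper : Real.cos (2 * Real.pi * (0 : ℝ)) = Real.cos (2 * Real.pi * (1 : ℝ)) ∧
      Real.sin (2 * Real.pi * (0 : ℝ)) = Real.sin (2 * Real.pi * (1 : ℝ)) := by
    simp [Real.cos_two_pi, Real.sin_two_pi]
  -- (i) the row lemma: `wind (f₂, g₂) = -ε wind (f₁, f₂)`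
  have hrow := wind_frameRow (ε := ε) (f₁ := f₁) (g₁ := g₁)
    (f₂ := fun t => p * Real.cos (2 * Real.pi * t) + r * Real.sin (2 * Real.pi * t))
    (g₂ := fun t => q * Real.cos (2 * Real.pi * t) + s * Real.sin (2 * Real.pi * t))
    hf₁ (by fun_prop) (by fun_prop) h₁ (by simp only [hper.1, hper.2]) (by simp only [hper.1, hper.2]) hε hdet
  -- (ii) `det M ≠ 0`: the row loop never vanishes
  have hneR : ∀ t : ℝ, (p * Real.cos (2 * Real.pi * t) + r * Real.sin (2 * Real.pi * t),
      q * Real.cos (2 * Real.pi * t) + s * Real.sin (2 * Real.pi * t)) ≠ (0, 0) := by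
    intro t h0
    rw [Prod.mk.injEq] at h0
    have := hdet t
    rw [h0.1, h0.2] at this; simp at this
  have hdetM : p * s - r * q ≠ 0 := det_ne_zero_of_linearLoop_ne_zero hneR
  -- (iii) `σ' = sign det M`; both `M u` and `Mᵀ u` wind `σ'` times
  obtain ⟨σ', hσ', hσ'det⟩ : ∃ σ' : ℤ, (σ' = 1 ∨ σ' = -1) ∧ 0 < (σ' : ℝ) * (p * s - r * q) := by
    rcases lt_or_gt_of_ne hdetM with h | h
    · exact ⟨-1, Or.inr rfl, by push_cast; linarith⟩
    · exact ⟨1, Or.inl rfl, by push_cast; linarith⟩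
  have hT : wind (fun t => (⟨p * Real.cos (2 * Real.pi * t) + r * Real.sin (2 * Real.pi * t),
      q * Real.cos (2 * Real.pi * t) + s * Real.sin (2 * Real.pi * t)⟩ : ℂ)) = σ' :=
    wind_linearLoop hσ' hσ'det
  have hM : wind (fun t => (⟨p * Real.cos (2 * Real.pi * t) + q * Real.sin (2 * Real.pi * t),
      r * Real.cos (2 * Real.pi * t) + s * Real.sin (2 * Real.pi * t)⟩ : ℂ)) = σ' :=
    wind_linearLoop hσ' (by linarith)
  have hMloop : IsNonvanishingLoop fun t => (⟨p * Real.cos (2 * Real.pi * t) + q * Real.sin (2 * Real.pi * t),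
      r * Real.cos (2 * Real.pi * t) + s * Real.sin (2 * Real.pi * t)⟩ : ℂ) := by
    refine ⟨(continuous_complex_mk (by fun_prop) (by fun_prop)).continuousOn, fun t _ h0 => ?_,
      by apply Complex.ext <;> simp [Real.cos_two_pi, Real.sin_two_pi]⟩
    have e1 : p * Real.cos (2 * Real.pi * t) + q * Real.sin (2 * Real.pi * t) = 0 := congrArg Complex.re h0
    have e2 : r * Real.cos (2 * Real.pi * t) + s * Real.sin (2 * Real.pi * t) = 0 := congrArg Complex.im h0
    have hCS := Real.cos_sq_add_sin_sq (2 * Real.pi * t)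
    apply hdetM
    nlinarith [sq_nonneg (p * s - r * q), sq_nonneg (Real.cos (2 * Real.pi * t)),
      sq_nonneg (Real.sin (2 * Real.pi * t)),
      show (p * s - r * q) * Real.cos (2 * Real.pi * t) = 0 by linear_combination s * e1 - q * e2,
      show (p * s - r * q) * Real.sin (2 * Real.pi * t) = 0 by linear_combination (-r) * e1 + p * e2]
  have hσ'eq : (σ' : ℤ) = -ε * wind (fun t => (⟨f₁ t,
      p * Real.cos (2 * Real.pi * t) + r * Real.sin (2 * Real.pi * t)⟩ : ℂ)) := hT.symm.trans hrow
  -- (iv) `wind m = -σ · wind (M u)`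
  have hm : wind (fun t => (⟨σ * (r * Real.cos (2 * Real.pi * t) + s * Real.sin (2 * Real.pi * t)),
      p * Real.cos (2 * Real.pi * t) + q * Real.sin (2 * Real.pi * t)⟩ : ℂ)) = -σ * σ' := by
    rcases hσ with h | h
    · subst h
      calc wind (fun t => (⟨((1 : ℤ) : ℝ) * (r * Real.cos (2 * Real.pi * t) + s * Real.sin (2 * Real.pi * t)),
            p * Real.cos (2 * Real.pi * t) + q * Real.sin (2 * Real.pi * t)⟩ : ℂ))
          = wind (fun t => (⟨((⟨p * Real.cos (2 * Real.pi * t) + q * Real.sin (2 * Real.pi * t),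
              r * Real.cos (2 * Real.pi * t) + s * Real.sin (2 * Real.pi * t)⟩ : ℂ)).im,
              ((⟨p * Real.cos (2 * Real.pi * t) + q * Real.sin (2 * Real.pi * t),
              r * Real.cos (2 * Real.pi * t) + s * Real.sin (2 * Real.pi * t)⟩ : ℂ)).re⟩ : ℂ)) := by
            apply congrArg; funext t; apply Complex.ext <;> simp
        _ = -(σ' : ℤ) := by rw [wind_swap hMloop, hM]
        _ = -(1 : ℤ) * σ' := by ring
    · subst h
      calc wind (fun t => (⟨((-1 : ℤ) : ℝ) * (r * Real.cos (2 * Real.pi * t) + s * Real.sin (2 * Real.pi * t)),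
            p * Real.cos (2 * Real.pi * t) + q * Real.sin (2 * Real.pi * t)⟩ : ℂ))
          = wind (fun t => (⟨-((⟨p * Real.cos (2 * Real.pi * t) + q * Real.sin (2 * Real.pi * t),
              r * Real.cos (2 * Real.pi * t) + s * Real.sin (2 * Real.pi * t)⟩ : ℂ)).im,
              ((⟨p * Real.cos (2 * Real.pi * t) + q * Real.sin (2 * Real.pi * t),
              r * Real.cos (2 * Real.pi * t) + s * Real.sin (2 * Real.pi * t)⟩ : ℂ)).re⟩ : ℂ)) := by
            apply congrArg; funext t; apply Complex.ext <;> simp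
        _ = (σ' : ℤ) := by rw [wind_rot hMloop, hM]
        _ = -(-1 : ℤ) * σ' := by ring
  rw [hm, hσ'eq]
  ring

/-- **Sub-goal `helper_wind_beltCount` of stub `stub_T3_dualPresentation`** (T3 ▸ node `Hgap` ▸ part B
`helper_Hgap_twisting`, brick G2-2, the winding count; wave 6, lead c5): for `M = [[p, q], [r, s]]`,
continuous `1`-periodic `f₁`, any `g₁`, signs `ε, σ = ±1` with
`0 < ε (f₁ (q cos + s sin) − g₁ (p cos + r sin))` everywhere, the loop
`(σ (r cos + s sin), p cos + q sin)` winds `σ · ε · wind (f₁, p cos + r sin)` times.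
[cite: EtnyreFuller2006, Thm. 1 (proof, p. 8)] -/
theorem helper_wind_beltCount : ∀ (p q r s : ℝ) (f₁ g₁ : ℝ → ℝ) (ε σ : ℤ), Continuous f₁ → f₁ 0 = f₁ 1 → (ε = 1 ∨ ε = -1) → (σ = 1 ∨ σ = -1) → (∀ t : ℝ, 0 < (ε : ℝ) * (f₁ t * (q * Real.cos (2 * Real.pi * t) + s * Real.sin (2 * Real.pi * t)) - g₁ t * (p * Real.cos (2 * Real.pi * t) + r * Real.sin (2 * Real.pi * t)))) → Literature.Topology.PlaneTopology.wind (fun t => (⟨σ * (r * Real.cos (2 * Real.pi * t) + s * Real.sin (2 * Real.pi * t)), p * Real.cos (2 * Real.pi * t) + q * Real.sin (2 * Real.pi * t)⟩ : ℂ)) = σ * ε * Literature.Topology.PlaneTopology.wind (fun t => (⟨f₁ t, p * Real.cos (2 * Real.pi * t) + r * Real.sin (2 * Real.pi * t)⟩ : ℂ)) :=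
  fun _ _ _ _ _ _ _ _ hf₁ h₁ hε hσ hdet => wind_beltCount hf₁ h₁ hε hσ hdet

end Summit.SmoothPoincare4.SmoothPoincare4.Theorems.AcyclicBisectionExists.ModpBraidOrbits

end
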